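import Summits.ResolutionOfSingularities.ResolutionOfSingularities.Theorems.PurelyInseparableDim4ResConeSlicesAlgClosed
import Summits.ResolutionOfSingularities.ResolutionOfSingularities.Theorems.PurelyInseparableDim4ResConeShadeOne
import HarnessLib

/-!
# Purely inseparable four-folds — K2(p) IS THE TWO MID-SHADE TAME SLICES OVER ALGEBRAICALLY CLOSED FIELDS:
# constant shade `2 ≤ d ≤ p − 1`, `e_G ∈ {2, 3}` (the located residue of record, every prime; assembly only)

[OURS · counted 0 · cell `res-dim4-pi` · K2(p) lane (holder res-dim4-p-12 g3) · seat res-dim4-p-2 g3 (E2 / p-program /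
F4-I row holder, assembly-level bookkeeping per desk WORDS #74 (a) / #78 (b)).]  Nothing here proves K2(p) =
`RidgeBudget.NoAboveFloorTrap p p`, `NoIsolatedTrap p p`, the Cossart–Jannsen–Saito theorem or resolution of
singularities in dimension ≥ 4 / characteristic `p`.

Pure composition of THREE landed reductions of K2(p) (no new mathematics):
* res-dim4-p-12 g2's `ResCone.noAboveFloorTrap_iff_tameSlices` (p673897) in res-dim4-p-3 g3's algebraically closed
  form `K2BaseChange.noAboveFloorTrap_of_no_tameSlices_algClosed` (p674782-…SlicesAlgClosed): K2(p) ⟸ no located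
  constant-`(d, e_G = 3)` chain and no located constant-`(d, e_G = 2)` chain with `1 ≤ d < p`, over every `K = K̄`;
* res-dim4-p-7 g2's `ResCone.no_constantShadeOneTrap` (…ShadeOne, idea-4's CORNER LOCK I-4-3): the phase `d = 1` is
  EMPTY over every field (no characteristic hypothesis).
Hence **`noAboveFloorTrap_of_no_midTameSlices_algClosed`** / **`noAboveFloorTrap_iff_midTameSlices_algClosed`**:
`K2(p) ⟺` over every ALGEBRAICALLY CLOSED field of characteristic `p` there is no isolated above-floor `Step0 p` chain
with `x^{r₀} ∣ F₀`, constant shade `2 ≤ d < p` and constant `finrank (resVertex (c k)) = 3` (slice B′, power cones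
`a·ℓ^d`, frame `ResCone.chain_powerCone_package`), nor one with `= 2` (slice C′, binary cones); and the all-fields form
`noAboveFloorTrap_iff_midTameSlices`.  At `p = 5` the located residue of the cell's F4-I question (modulo F-111) is
thus `d ∈ {2, 3, 4} × e_G ∈ {2, 3}` over `K = K̄` — NUMBERS that locate what is open; they prove nothing about it.
bears_on: LADDER-RESOLUTION:D157-DOOR2 (res-dim4-pi · K2(p) · located residue).  Supports
stmt-ResolutionOfSingularities-16155 (helper).
-/

set_option linter.dupNamespace false -- mandated namespace of this single-conjunct summit

noncomputable section

namespace Summit.ResolutionOfSingularities.ResolutionOfSingularities.Theorems.PIDim4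

namespace K2BaseChange

open MvPolynomial
open Literature.AlgebraicGeometry.Resolution
open Literature.AlgebraicGeometry.Resolution.CentreBlowup
open Literature.AlgebraicGeometry.Resolution.Hauser2010
open Literature.AlgebraicGeometry.Resolution.HauserPerlega2019
open RidgeBudget (NoAboveFloorTrap)
open ResCone (resForm resVertex)

/-- **Phase `d = 1` discharged inside a tame slice** (any field, any `e`): a located constant-`(d, e_G = e)` chain
with `1 ≤ d < p` has in fact `2 ≤ d`, because `d = 1` is res-dim4-p-7 g2's empty phase
(`ResCone.no_constantShadeOneTrap`). [OURS · bookkeeping] [folklore] -/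
theorem no_tameSlice_of_no_midSlice (p e : ℕ) [Fact p.Prime] (L : Type) [Field L] [CharP L p] [DecidableEq L]
    (h : ¬ ∃ (c : ℕ → State L) (d : ℕ), 2 ≤ d ∧ d < p ∧
        (∀ e' ∈ (c 0).F.support, (c 0).r ≤ e') ∧
        ∀ k, IsIsolated p (c k).F ∧ Step0 p (c k) (c (k + 1)) ∧ ordZero (c k).F ≠ p ∧
          (c k).shade = (d : ℕ∞) ∧ Module.finrank L (resVertex (c k)) = e) :
    ¬ ∃ (c : ℕ → State L) (d : ℕ), 1 ≤ d ∧ d < p ∧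
        (∀ e' ∈ (c 0).F.support, (c 0).r ≤ e') ∧
        ∀ k, IsIsolated p (c k).F ∧ Step0 p (c k) (c (k + 1)) ∧ ordZero (c k).F ≠ p ∧
          (c k).shade = (d : ℕ∞) ∧ Module.finrank L (resVertex (c k)) = e := by
  rintro ⟨c, d, hd1, hdp, hr0, hc⟩
  by_cases hd : d = 1
  · subst hd
    exact ResCone.no_constantShadeOneTrap p L ⟨c, hr0, fun k =>
      ⟨(hc k).1, (hc k).2.1, (hc k).2.2.1, by rw [(hc k).2.2.2.1, Nat.cast_one]⟩⟩
  · exact h ⟨c, d, by omega, hdp, hr0, hc⟩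

/-- **K2(p) FROM THE TWO MID-SHADE TAME SLICES OVER ALGEBRAICALLY CLOSED FIELDS** (`p` prime; the assembly form
slice hands should target): if no algebraically closed field of characteristic `p` carries a located power-cone
chain (`2 ≤ d < p`, `e_G ≡ 3`) and none carries a located binary-cone chain (`2 ≤ d < p`, `e_G ≡ 2`), then
`RidgeBudget.NoAboveFloorTrap p p`. [OURS · bookkeeping] [cite: CossartJannsenSaito2020, Thm. 3.14] -/
theorem noAboveFloorTrap_of_no_midTameSlices_algClosed (p : ℕ) [Fact p.Prime]
    (hB : ∀ (L : Type) [Field L] [IsAlgClosed L] [CharP L p] [DecidableEq L],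
      ¬ ∃ (c : ℕ → State L) (d : ℕ), 2 ≤ d ∧ d < p ∧
          (∀ e' ∈ (c 0).F.support, (c 0).r ≤ e') ∧
          ∀ k, IsIsolated p (c k).F ∧ Step0 p (c k) (c (k + 1)) ∧ ordZero (c k).F ≠ p ∧
            (c k).shade = (d : ℕ∞) ∧ Module.finrank L (resVertex (c k)) = 3)
    (hC : ∀ (L : Type) [Field L] [IsAlgClosed L] [CharP L p] [DecidableEq L],
      ¬ ∃ (c : ℕ → State L) (d : ℕ), 2 ≤ d ∧ d < p ∧
          (∀ e' ∈ (c 0).F.support, (c 0).r ≤ e') ∧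
          ∀ k, IsIsolated p (c k).F ∧ Step0 p (c k) (c (k + 1)) ∧ ordZero (c k).F ≠ p ∧
            (c k).shade = (d : ℕ∞) ∧ Module.finrank L (resVertex (c k)) = 2) :
    NoAboveFloorTrap p p :=
  noAboveFloorTrap_of_no_tameSlices_algClosed p
    (fun L _ _ _ _ => no_tameSlice_of_no_midSlice p 3 L (hB L))
    (fun L _ _ _ _ => no_tameSlice_of_no_midSlice p 2 L (hC L))

/-- **K2(p) ⟺ THE TWO MID-SHADE TAME SLICES ARE EMPTY OVER ALGEBRAICALLY CLOSED FIELDS** (`p` prime): the located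
residue of record — constant shade `2 ≤ d ≤ p − 1`, `e_G ∈ {2, 3}`, `K = K̄`; at `p = 5`, `d ∈ {2, 3, 4}`.
[OURS · bookkeeping] [cite: CossartJannsenSaito2020, Thm. 3.14] -/
theorem noAboveFloorTrap_iff_midTameSlices_algClosed (p : ℕ) [Fact p.Prime] :
    NoAboveFloorTrap p p ↔ ∀ (L : Type) [Field L] [IsAlgClosed L] [CharP L p] [DecidableEq L],
      (¬ ∃ (c : ℕ → State L) (d : ℕ), 2 ≤ d ∧ d < p ∧
          (∀ e' ∈ (c 0).F.support, (c 0).r ≤ e') ∧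
          ∀ k, IsIsolated p (c k).F ∧ Step0 p (c k) (c (k + 1)) ∧ ordZero (c k).F ≠ p ∧
            (c k).shade = (d : ℕ∞) ∧ Module.finrank L (resVertex (c k)) = 3) ∧
      (¬ ∃ (c : ℕ → State L) (d : ℕ), 2 ≤ d ∧ d < p ∧
          (∀ e' ∈ (c 0).F.support, (c 0).r ≤ e') ∧
          ∀ k, IsIsolated p (c k).F ∧ Step0 p (c k) (c (k + 1)) ∧ ordZero (c k).F ≠ p ∧
            (c k).shade = (d : ℕ∞) ∧ Module.finrank L (resVertex (c k)) = 2) := by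
  refine ⟨fun h L _ _ _ _ => ?_, fun h => ?_⟩
  · obtain ⟨hB, hC⟩ := (noAboveFloorTrap_iff_tameSlices_algClosed p).mp h L
    exact ⟨fun ⟨c, d, hd2, hdp, hr0, hc⟩ => hB ⟨c, d, by omega, hdp, hr0, hc⟩,
      fun ⟨c, d, hd2, hdp, hr0, hc⟩ => hC ⟨c, d, by omega, hdp, hr0, hc⟩⟩
  · exact noAboveFloorTrap_of_no_midTameSlices_algClosed p (fun L _ _ _ _ => (h L).1)
      (fun L _ _ _ _ => (h L).2)

/-- **K2(p) ⟺ THE TWO MID-SHADE TAME SLICES ARE EMPTY** (every field of characteristic `p`; the same without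
`[IsAlgClosed]`). [OURS · bookkeeping] [cite: CossartJannsenSaito2020, Thm. 3.14] -/
theorem noAboveFloorTrap_iff_midTameSlices (p : ℕ) [Fact p.Prime] :
    NoAboveFloorTrap p p ↔ ∀ (K : Type) [Field K] [CharP K p] [DecidableEq K],
      (¬ ∃ (c : ℕ → State K) (d : ℕ), 2 ≤ d ∧ d < p ∧
          (∀ e' ∈ (c 0).F.support, (c 0).r ≤ e') ∧
          ∀ k, IsIsolated p (c k).F ∧ Step0 p (c k) (c (k + 1)) ∧ ordZero (c k).F ≠ p ∧
            (c k).shade = (d : ℕ∞) ∧ Module.finrank K (resVertex (c k)) = 3) ∧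
      (¬ ∃ (c : ℕ → State K) (d : ℕ), 2 ≤ d ∧ d < p ∧
          (∀ e' ∈ (c 0).F.support, (c 0).r ≤ e') ∧
          ∀ k, IsIsolated p (c k).F ∧ Step0 p (c k) (c (k + 1)) ∧ ordZero (c k).F ≠ p ∧
            (c k).shade = (d : ℕ∞) ∧ Module.finrank K (resVertex (c k)) = 2) := by
  refine ⟨fun h K _ _ _ => ?_, fun h => ?_⟩
  · obtain ⟨hB, hC⟩ := (ResCone.noAboveFloorTrap_iff_tameSlices p).mp h K
    exact ⟨fun ⟨c, d, hd2, hdp, hr0, hc⟩ => hB ⟨c, d, by omega, hdp, hr0, hc⟩,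
      fun ⟨c, d, hd2, hdp, hr0, hc⟩ => hC ⟨c, d, by omega, hdp, hr0, hc⟩⟩
  · letI : ∀ (L : Type) [Field L], DecidableEq L := fun L _ => Classical.decEq L
    exact noAboveFloorTrap_of_no_midTameSlices_algClosed p (fun L _ _ _ _ => (h L).1)
      (fun L _ _ _ _ => (h L).2)

end K2BaseChange

end Summit.ResolutionOfSingularities.ResolutionOfSingularities.Theorems.PIDim4

end
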